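import Summits.BirchSwinnertonDyer.Rank1Residual.AdditivePotMult.QuadraticBaseChangeOddTamagawaSemistableTwo
import Summits.BirchSwinnertonDyer.Rank1Residual.AdditivePotMult.QuadraticBaseChangeTamagawaAdditiveUnramified
import HarnessLib

/-!
# The odd Tamagawa identity for `p ≥ 5` on S₂: additive places of residue characteristic `≥ 5`
# prime to `d_K` allowed (row T-MIL-ODD, FILE C-3g; seat n1011-p01 GEN 6)

HONEST FRAMING (cell `b2b-bsdres`, run/shared/lean/b2b/bsd-rank1-residual/, verbatim in every
file): the goal of the cell is to DELETE the COMBINATION-SHAPED residual classes of the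
Birch–Swinnerton-Dyer formula for ALL analytic-rank `≤ 1` elliptic curves over `ℚ` — "full BSD
formula for every rank `≤ 1` curve in class `C`" assembled STRICTLY from published theorems — so
that the rank-`≤ 1` remainder becomes exactly the CONSTRUCTION-SHAPED classes, which are TYPED
(missing-input `Prop`s), NOT attempted. This is not "finishing BSD". Sub-classes X3♯(M) / X4(M)
(additive, potentially multiplicative prime; base-change-and-descend): a RESEARCH ROUTE; they stay
CONSTRUCTION-SHAPED; nothing is booked by this file; no mark / label moved. THEOREMS ONLY: no
definition, no named fact, no `sorry`.

## What (row T-MIL-ODD, `cells/n1011/skel/T-MIL-ODD.md` §1 (A≥5), §6)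

FILES C-3d/C-3f proved the odd Tamagawa identity of Milne's quadratic BSD quotient for curves whose
bad places are multiplicative or potentially multiplicative ramified (population S₁), every odd
`p`. With FILE A-5K (additive reduction persists above an UNRAMIFIED place of residue characteristic
`≥ 5`, fact-free) and stage A-5a (`QuadraticTwistTamagawaAdditive`: the unit twist at an additive odd
place is additive with the same `ord Δ_min`) this file admits, for `p ≥ 5`, arbitrary ADDITIVE
places `ℓ ≥ 5` of `W` prime to `d_K` (population S₂):

* `sum_fibre_padicValNat_localTamagawaNumber_of_addv_of_inert` — (T) at an inert additive place
  `ℓ ≥ 5` (both sides `0`: `c ≤ 4` on all three curves);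
* `valuation_u_twist_eq_one_of_not_dvd_of_addv` — `|C_d.u|_v = 1` there (`ord Δ_min` unchanged);
* `sum_fibre_padicValNat_localTamagawaNumber_of_semistable_or_addv`,
  `sum_fibre_inertiaDeg_mul_ord_u_eq_of_semistable_or_addv` — (T) and (D) from the local S₂
  hypothesis (split additive places: FILE C-3b `…_of_split`, any reduction);
* `padicValRat_norm_mul_tamagawaProduct_eq_of_semistable_or_addv` — **THE END on S₂, `p ≥ 5`**:
  for `W/ℚ` globally minimal elliptic, `K` quadratic with `d_K` odd squarefree, globally minimal
  `W_d = C_d • W^{(d_K)}`, `W' = C' • W_K`, and `hS : ∀ v`, `W` good ∨ `W` multiplicative ∨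
  (`ℓ_v ∣ d_K` ∧ `W_d` multiplicative) ∨ (`W` additive ∧ `ℓ_v ∤ d_K` ∧ `ℓ_v ≥ 5`), every prime
  `p ≥ 5`: `v_p(|N_{K/ℚ}(C'.u)| · ∏_w c_w(W')) = v_p(|C_d.u| · ∏_v c_v(W) · ∏_v c_v(W_d))` — the
  body of `hodd` in the tree's `bsdRHS_baseChange_quadratic_of_padicValRat`.

For `K = ℚ(√p*)`, `p ≥ 5`: every X3♯(M)/X4(M) curve whose further additive primes are all `≥ 5`
(conductor `p² · N'` with `N'` prime to `6p` or squarefree at `2, 3`). HONEST LIMITS: `p ≥ 5`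
(at `p = 3` an additive place may have `3 ∣ c`: types IV/IV*, row T-MIL-B); additive places `2`,
`3` and additive places dividing `d_K` other than the potentially multiplicative one NOT covered
(Tate's algorithm / fact A233); even `d_K` not covered; closes no class; moves no mark; no consumer
binder changed.
-/

noncomputable section

open scoped Classical NumberField

open WeierstrassCurve NumberField IsDedekindDomain Rat.HeightOneSpectrum WithZero
  Literature.NumberTheory.EllipticCurves
  Summit.BirchSwinnertonDyer.Rank1Residual.Additive

namespace Summit.BirchSwinnertonDyer.Rank1Residual.AdditivePotMult

section AdditiveUnramified

variable (W : WeierstrassCurve ℚ) [W.IsElliptic] [W.IsGloballyMinimal] {K : Type} [Field K]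
  [NumberField K] (Wd : WeierstrassCurve ℚ) (p : ℕ) [hp : Fact p.Prime] (v : HeightOneSpectrum (𝓞 ℚ))

/-- **(T) at an INERT ADDITIVE place of residue characteristic `≥ 5`, `p ≥ 5`** (`W/ℚ` globally
minimal additive at `v`, single place `w` above `v` with `e = 1`, `ℓ_v ∤ d`, `W_d = C_d • W^{(d)}`):
`v_p(c_w(W_K)) = 0 = v_p(c_v(W)) + v_p(c_v(W_d))` — `W_K` additive at `w` (FILE A-5K), `W` and
`W^{(d)}` additive at `v` (stage A-5a), all `c ≤ 4 < p`. [cite: SilvermanAEC2009, Thm. VII.6.1 and Prop. VII.5.4(a)] -/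
theorem sum_fibre_padicValNat_localTamagawaNumber_of_addv_of_inert {d : ℤ}
    (hd : ¬ ((primesEquiv v : ℕ) : ℤ) ∣ d) {Cd : VariableChange ℚ}
    (hWd : Cd • W.quadraticTwist (d : ℚ) = Wd) (h5 : 5 ≤ (primesEquiv v : ℕ))
    (hadd : W.HasAdditiveReductionAt v) {w : HeightOneSpectrum (𝓞 K)}
    (hset : {w' : HeightOneSpectrum (𝓞 K) | w'.under (𝓞 ℚ) = v} = {w})
    (he : w.asIdeal.ramificationIdx (𝓞 ℚ) = 1) (hp5 : 5 ≤ p) :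
    ∑ w ∈ (HeightOneSpectrum.finite_setOf_under_eq_of_numberField (K := K) v).toFinset,
        padicValNat p (((W.baseChange K).baseChange (w.adicCompletion K)).localTamagawaNumber
          (w.adicCompletionIntegers K)) =
      padicValNat p ((W.baseChange (v.adicCompletion ℚ)).localTamagawaNumber
          (v.adicCompletionIntegers ℚ)) +
        padicValNat p ((Wd.baseChange (v.adicCompletion ℚ)).localTamagawaNumber
          (v.adicCompletionIntegers ℚ)) := by
  have hw : w.under (𝓞 ℚ) = v := under_eq_of_fibre_eq_singleton hset
  have hv2 : (primesEquiv v : ℕ) ≠ 2 := by omega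
  have hd0 : (d : ℚ) ≠ 0 := by
    have : d ≠ 0 := by rintro rfl; exact hd (dvd_zero _)
    exact_mod_cast this
  haveI := W.isElliptic_quadraticTwist hd0
  rw [toFinset_eq_singleton_of_fibre hset, Finset.sum_singleton,
    padicValNat_localTamagawaNumber_baseChange_eq_zero_of_addv_of_five_le W w h5 hw he hadd p hp5,
    localTamagawaNumber_eq_of_variableChange_eq hWd v]
  exact (padicValNat_localTamagawaNumber_add_quadraticTwist_eq_zero_of_addv_of_five_le W v hv2 hd
    hadd p hp5).symm

variable [Wd.IsElliptic] [Wd.IsGloballyMinimal]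

omit hp in
/-- `|C_d.u|_v = 1` at an ADDITIVE odd place with `ℓ ∤ d` (`ord Δ_min(W^{(d)}) = ord Δ_min(W)`,
stage A-5a `hasAdditiveReductionAt_quadraticTwist_of_not_dvd`; master identity of FILE C-3c).
[cite: SilvermanAEC2009, VII.1 Prop. 1.3(a)] -/
theorem valuation_u_twist_eq_one_of_not_dvd_of_addv (hv2 : (primesEquiv v : ℕ) ≠ 2) {d : ℤ}
    (hd0 : d ≠ 0) (hd : ¬ ((primesEquiv v : ℕ) : ℤ) ∣ d) {Cd : VariableChange ℚ}
    (hWd : Cd • W.quadraticTwist (d : ℚ) = Wd) (hadd : W.HasAdditiveReductionAt v) :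
    v.valuation ℚ (Cd.u : ℚ) = 1 := by
  have hdq : (d : ℚ) ≠ 0 := by exact_mod_cast hd0
  haveI := W.isElliptic_quadraticTwist hdq
  have h := twelve_mul_log_valuation_u_eq W Wd v hd0 hWd
  obtain ⟨-, hordT⟩ := hasAdditiveReductionAt_quadraticTwist_of_not_dvd W v hv2 hd hadd
  have hordWd : Wd.ordMinimalDiscriminant v = W.ordMinimalDiscriminant v := by
    rw [← hWd, ordMinimalDiscriminant_smul_holds v (W.quadraticTwist (d : ℚ)) Cd, hordT]
  rw [hordWd, valuation_ringOfIntegers_intCast_eq_one v hd, log_one] at h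
  have hu0 : v.valuation ℚ (Cd.u : ℚ) ≠ 0 := (Valuation.ne_zero_iff _).mpr (Units.ne_zero _)
  rw [← exp_log hu0, ← exp_zero, exp_inj]
  simpa using h

end AdditiveUnramified

section End

variable (W : WeierstrassCurve ℚ) [W.IsElliptic] [W.IsGloballyMinimal]
  (K : Type) [Field K] [NumberField K] (Wd : WeierstrassCurve ℚ) [Wd.IsElliptic] [Wd.IsGloballyMinimal]
  (W' : WeierstrassCurve K) [W'.IsGloballyMinimal]

/-- **(T) at a place from the local S₂ hypothesis, `p ≥ 5`**: FILE C-3f for the S₁ cases; at an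
additive place `ℓ ≥ 5` prime to `d_K`: split (FILE C-3b, any reduction) or inert
(`sum_fibre_padicValNat_localTamagawaNumber_of_addv_of_inert`); ramified is excluded by `ℓ ∤ d_K`.
[cite: Milne1972ArithmeticAV, §1 Thm. 1 and §2 (through DokchitserDokchitserAnnals2010, §2.1, proof of Thm. 8)] -/
theorem sum_fibre_padicValNat_localTamagawaNumber_of_semistable_or_addv (h2 : Module.finrank ℚ K = 2)
    (hdodd : Odd (NumberField.discr K)) (hdsq : Squarefree (NumberField.discr K))
    {Cd : VariableChange ℚ} (hWd : Cd • W.quadraticTwist (NumberField.discr K : ℚ) = Wd)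
    (p : ℕ) [Fact p.Prime] (hp5 : 5 ≤ p) (v : HeightOneSpectrum (𝓞 ℚ))
    (hSv : W.HasGoodReductionAt v ∨ W.HasMultiplicativeReductionAt v ∨
      (((primesEquiv v : ℕ) : ℤ) ∣ NumberField.discr K ∧ Wd.HasMultiplicativeReductionAt v) ∨
      (W.HasAdditiveReductionAt v ∧ ¬ ((primesEquiv v : ℕ) : ℤ) ∣ NumberField.discr K ∧
        5 ≤ (primesEquiv v : ℕ))) :
    ∑ w ∈ (HeightOneSpectrum.finite_setOf_under_eq_of_numberField (K := K) v).toFinset,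
        padicValNat p (((W.baseChange K).baseChange (w.adicCompletion K)).localTamagawaNumber
          (w.adicCompletionIntegers K)) =
      padicValNat p ((W.baseChange (v.adicCompletion ℚ)).localTamagawaNumber
          (v.adicCompletionIntegers ℚ)) +
        padicValNat p ((Wd.baseChange (v.adicCompletion ℚ)).localTamagawaNumber
          (v.adicCompletionIntegers ℚ)) := by
  have hp2 : p ≠ 2 := by omega
  rcases hSv with h | h | h | ⟨hadd, hnd, h5⟩
  · exact sum_fibre_padicValNat_localTamagawaNumber_of_semistable' W K Wd h2 hdodd hdsq hWd p hp2 v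
      (Or.inl h)
  · exact sum_fibre_padicValNat_localTamagawaNumber_of_semistable' W K Wd h2 hdodd hdsq hWd p hp2 v
      (Or.inr (Or.inl h))
  · exact sum_fibre_padicValNat_localTamagawaNumber_of_semistable' W K Wd h2 hdodd hdsq hWd p hp2 v
      (Or.inr (Or.inr h))
  · rcases placesOver_trichotomy_of_finrank_eq_two K h2 v with
      ⟨w₁, w₂, hne, hset, hef⟩ | ⟨w, hset, he, hf⟩ | ⟨w, hset, he, hf⟩
    · exact sum_fibre_padicValNat_localTamagawaNumber_of_split W Wd p v h2 hWd hne hset hef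
    · exact sum_fibre_padicValNat_localTamagawaNumber_of_addv_of_inert W Wd p v hnd hWd h5 hadd hset he
        hp5
    · exact absurd (natCast_dvd_discr_of_ramificationIdx_eq_two K v
        (under_eq_of_fibre_eq_singleton hset) he) hnd

/-- **(D) at an odd place `v₀` from the local S₂ hypothesis**: FILE C-3f for the S₁ cases; at an
additive `v₀` with `ℓ ≥ 5`, `ℓ ∤ d_K`: all unit terms vanish (FILE A-5K
`ordMinimalDiscriminant_baseChange_eq_of_five_le_of_ramificationIdx_eq_one` with FILE C-3c
`valuation_u_eq_one_of_ordMinimalDiscriminant_eq`; `valuation_u_twist_eq_one_of_not_dvd_of_addv`).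
[cite: SilvermanAEC2009, VII.1 Prop. 1.3(a)–(b) and VIII.8] -/
theorem sum_fibre_inertiaDeg_mul_ord_u_eq_of_semistable_or_addv (h2 : Module.finrank ℚ K = 2)
    (hdsq : Squarefree (NumberField.discr K))
    {Cd : VariableChange ℚ} (hWd : Cd • W.quadraticTwist (NumberField.discr K : ℚ) = Wd)
    {C' : VariableChange K} (hW' : C' • W.baseChange K = W')
    (v₀ : HeightOneSpectrum (𝓞 ℚ)) (hv₀2 : (primesEquiv v₀ : ℕ) ≠ 2)
    (hS₀ : W.HasGoodReductionAt v₀ ∨ W.HasMultiplicativeReductionAt v₀ ∨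
      (((primesEquiv v₀ : ℕ) : ℤ) ∣ NumberField.discr K ∧ Wd.HasMultiplicativeReductionAt v₀) ∨
      (W.HasAdditiveReductionAt v₀ ∧ ¬ ((primesEquiv v₀ : ℕ) : ℤ) ∣ NumberField.discr K ∧
        5 ≤ (primesEquiv v₀ : ℕ))) :
    ∑ w ∈ (HeightOneSpectrum.finite_setOf_under_eq_of_numberField (K := K) v₀).toFinset,
        (w.asIdeal.inertiaDeg (𝓞 ℚ) : ℤ) * (-log (w.valuation K (C'.u : K))) =
      -log (v₀.valuation ℚ (Cd.u : ℚ)) := by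
  rcases hS₀ with h | h | h | ⟨hadd, hnd, h5⟩
  · exact sum_fibre_inertiaDeg_mul_ord_u_eq_of_semistable' W K Wd W' h2 hdsq hWd hW' v₀ hv₀2 (Or.inl h)
  · exact sum_fibre_inertiaDeg_mul_ord_u_eq_of_semistable' W K Wd W' h2 hdsq hWd hW' v₀ hv₀2
      (Or.inr (Or.inl h))
  · exact sum_fibre_inertiaDeg_mul_ord_u_eq_of_semistable' W K Wd W' h2 hdsq hWd hW' v₀ hv₀2
      (Or.inr (Or.inr h))
  · have hd0 : (NumberField.discr K : ℤ) ≠ 0 := NumberField.discr_ne_zero K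
    have hmin : ∀ w : HeightOneSpectrum (𝓞 K), W'.IsMinimalAt w := fun w =>
      IsGloballyMinimal.isMinimal (W := W') w
    have hud : v₀.valuation ℚ (Cd.u : ℚ) = 1 :=
      valuation_u_twist_eq_one_of_not_dvd_of_addv W Wd v₀ hv₀2 hd0 hnd hWd hadd
    rcases placesOver_trichotomy_of_finrank_eq_two K h2 v₀ with
      ⟨w₁, w₂, hne, hset, hef⟩ | ⟨w, hset, he, hf⟩ | ⟨w, hset, he, hf⟩
    · have hw₁ : w₁.under (𝓞 ℚ) = v₀ := by
        have h : w₁ ∈ ({w₁, w₂} : Set (HeightOneSpectrum (𝓞 K))) := Set.mem_insert _ _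
        rwa [← hset] at h
      have hw₂ : w₂.under (𝓞 ℚ) = v₀ := by
        have h : w₂ ∈ ({w₁, w₂} : Set (HeightOneSpectrum (𝓞 K))) :=
          Set.mem_insert_of_mem _ (Set.mem_singleton _)
        rwa [← hset] at h
      rw [toFinset_eq_pair_of_fibre hset, Finset.sum_pair hne,
        valuation_u_eq_one_of_ordMinimalDiscriminant_eq W w₁ hw₁ hW' (hmin w₁)
          (ordMinimalDiscriminant_baseChange_eq_of_five_le_of_ramificationIdx_eq_one W w₁ h5 hw₁
            (hef w₁ hw₁).1),
        valuation_u_eq_one_of_ordMinimalDiscriminant_eq W w₂ hw₂ hW' (hmin w₂)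
          (ordMinimalDiscriminant_baseChange_eq_of_five_le_of_ramificationIdx_eq_one W w₂ h5 hw₂
            (hef w₂ hw₂).1), hud, log_one]
      simp
    · have hw : w.under (𝓞 ℚ) = v₀ := under_eq_of_fibre_eq_singleton hset
      rw [toFinset_eq_singleton_of_fibre hset, Finset.sum_singleton,
        valuation_u_eq_one_of_ordMinimalDiscriminant_eq W w hw hW' (hmin w)
          (ordMinimalDiscriminant_baseChange_eq_of_five_le_of_ramificationIdx_eq_one W w h5 hw he),
        hud, log_one]
      simp
    · exact absurd (natCast_dvd_discr_of_ramificationIdx_eq_two K v₀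
        (under_eq_of_fibre_eq_singleton hset) he) hnd

/-- **THE ODD TAMAGAWA IDENTITY ON S₂ (every `p ≥ 5`).** For `W/ℚ` globally minimal elliptic, `K`
quadratic with `d_K` odd squarefree, globally minimal models `W_d = C_d • W^{(d_K)}`, `W' = C' • W_K`,
and `hS`: at every place `W` is good, or multiplicative, or the place divides `d_K` and `W_d` is
multiplicative there, or `W` is additive at a place of residue characteristic `≥ 5` not dividing
`d_K`; then for every prime `p ≥ 5`
`v_p(|N_{K/ℚ}(C'.u)| · ∏_w c_w(W')) = v_p(|C_d.u| · ∏_v c_v(W) · ∏_v c_v(W_d))` (assembly schema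
FILE C-2 with (T) and (P) = (T) + (D) above). Extends FILE C-3f's `…_of_semistable'` (`p ≥ 5` only).
[cite: Milne1972ArithmeticAV, §1 Thm. 1 and §2 (through DokchitserDokchitserAnnals2010, §2.1, proof of Thm. 8)] -/
theorem padicValRat_norm_mul_tamagawaProduct_eq_of_semistable_or_addv (h2 : Module.finrank ℚ K = 2)
    (hdodd : Odd (NumberField.discr K)) (hdsq : Squarefree (NumberField.discr K))
    {Cd : VariableChange ℚ} (hWd : Cd • W.quadraticTwist (NumberField.discr K : ℚ) = Wd)
    {C' : VariableChange K} (hW' : C' • W.baseChange K = W')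
    (hS : ∀ v : HeightOneSpectrum (𝓞 ℚ), W.HasGoodReductionAt v ∨ W.HasMultiplicativeReductionAt v ∨
      (((primesEquiv v : ℕ) : ℤ) ∣ NumberField.discr K ∧ Wd.HasMultiplicativeReductionAt v) ∨
      (W.HasAdditiveReductionAt v ∧ ¬ ((primesEquiv v : ℕ) : ℤ) ∣ NumberField.discr K ∧
        5 ≤ (primesEquiv v : ℕ)))
    (p : ℕ) [hp : Fact p.Prime] (hp5 : 5 ≤ p) :
    padicValRat p (|Algebra.norm ℚ (C'.u : K)| * W'.tamagawaProduct : ℚ) =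
      padicValRat p (|(Cd.u : ℚ)| * (W.tamagawaProduct * Wd.tamagawaProduct) : ℚ) := by
  set v₀ : HeightOneSpectrum (𝓞 ℚ) := (primesEquiv (R := 𝓞 ℚ)).symm ⟨p, hp.out⟩ with hv₀def
  have hv₀ : (primesEquiv v₀ : ℕ) = p := by
    rw [hv₀def, Equiv.apply_symm_apply]
  have hv₀2 : (primesEquiv v₀ : ℕ) ≠ 2 := by rw [hv₀]; omega
  have hu' : (C'.u : K) ≠ 0 := Units.ne_zero _
  have hud : (Cd.u : ℚ) ≠ 0 := Units.ne_zero _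
  have hT := fun v => sum_fibre_padicValNat_localTamagawaNumber_of_semistable_or_addv W K Wd h2 hdodd
    hdsq hWd p hp5 v (hS v)
  have hD := sum_fibre_inertiaDeg_mul_ord_u_eq_of_semistable_or_addv W K Wd W' h2 hdsq hWd hW' v₀
    hv₀2 (hS v₀)
  refine padicValRat_norm_mul_tamagawaProduct_eq_of_local_baseChange W Wd W' hW' hu' hud p v₀ hv₀
    (fun v _ => hT v) ?_
  rw [Finset.sum_add_distrib, hD, ← Nat.cast_sum, hT v₀, Nat.cast_add]

end End

end Summit.BirchSwinnertonDyer.Rank1Residual.AdditivePotMult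

end
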